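import Mathlib.GroupTheory.Nilpotent
import Mathlib.GroupTheory.QuotientGroup.Basic
import Literature.Topology.FourManifolds.GroupTrisections
import HarnessLib

/-!
# Torsor calculus for the nilpotent shadows of a kernel triple — general group theory
# (helpers for crux `CongruenceShadows.NilpotentShadowsStandard`, stmt-SmoothPoincare4-14594, line saturated-torsor-descent)

For a group `G` with lower central series `γₖ₊₁ = (⊤ : Subgroup G).lowerCentralSeries k`, a normal subgroup `Q`
WITHOUT HIDDEN DEPTH (`Q ∩ γ₂ ≤ [Q, G]`; e.g. every honest handlebody kernel of a surface group, by the landed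
`stub_noHiddenDepth`) and a normal `P` with the same level-`c` shadow (`Q γ_{c+2} = P γ_{c+2}`):
* `commutator_sup_top_le` — `[A B, G] ≤ [A,G][B,G]`;
* `level_inf` — `(Q γ_{c+3}) ∩ γ_{c+2} = ([P,G] γ_{c+3}) ∩ γ_{c+2}`: the `γ`-part of the level-`(c+1)` kernel is
  determined by the level-`c` shadow;
* `level_data` — `Q γ_{c+3} = R γ_{c+3}` for every normal `R ≤ Q` generating `Q` modulo `γ_{c+2}` (the level-`(c+1)`
  kernel is the normal closure of ANY lifts of generators);
* `level_mem_iff` — the membership criterion `y ∈ Q γ_{c+3} ↔ y x⁻¹ u⁻¹ ∈ [P,G] γ_{c+3}` for a lift `u x ∈ Q` and an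
  automorphism value `y` with `y x⁻¹ ∈ γ_{c+2}`;
* `target_iff_quotient` — for `w ∈ γ_{c+2}`: `w ∈ [P,G] γ_{c+3} ↔ (w : G ⧸ P) ∈ γ_{c+3}(G ⧸ P)` (the torsor target
  is a quantity of the FREE quotient `G ⧸ P`).
Proved by a stub worker of the lead seat (wave 1, 2026-08-16); harvested verbatim (the abbreviation `lcs` unfolded).
-/

set_option linter.dupNamespace false

noncomputable section

open Subgroup
open scoped commutatorElement

namespace Summit.SmoothPoincare4.SmoothPoincare4.Theorems.NilpotentShadowsStandard.SaturatedTorsorDescent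

section General

variable {G : Type*} [Group G]

/-- `lcs` is antitone. [folklore] -/
theorem lcs_antitone {k l : ℕ} (h : k ≤ l) : ((⊤ : Subgroup G).lowerCentralSeries l) ≤ ((⊤ : Subgroup G).lowerCentralSeries k) :=
  Subgroup.lowerCentralSeries_antitone ⊤ h

/-- `lcs (k+1) = ⁅lcs k, ⊤⁆`. [folklore] -/
theorem lcs_succ (k : ℕ) : ((⊤ : Subgroup G).lowerCentralSeries (k + 1)) = ⁅((⊤ : Subgroup G).lowerCentralSeries k), (⊤ : Subgroup G)⁆ := rfl

/-- `⁅A ⊔ B, ⊤⁆ ≤ ⁅A, ⊤⁆ ⊔ ⁅B, ⊤⁆` for normal `A`, `B` (identity `⁅a b, q⁆ = a ⁅b, q⁆ a⁻¹ ⁅a, q⁆`).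
[folklore] -/
theorem commutator_sup_top_le (A B : Subgroup G) [A.Normal] [B.Normal] :
    ⁅A ⊔ B, (⊤ : Subgroup G)⁆ ≤ ⁅A, (⊤ : Subgroup G)⁆ ⊔ ⁅B, (⊤ : Subgroup G)⁆ := by
  -- adapted from the sibling scratch work/stubs/stub_reachOne_torsor.lean
  rw [commutator_le]
  intro p hp q _
  obtain ⟨a, ha, b, hb, rfl⟩ := mem_sup_of_normal_left.1 hp
  have key : ⁅a * b, q⁆ = a * ⁅b, q⁆ * a⁻¹ * ⁅a, q⁆ := by
    simp only [commutatorElement_def]; group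
  rw [key]
  refine mul_mem (mem_sup_right ?_) (mem_sup_left (commutator_mem_commutator ha (mem_top q)))
  exact (inferInstance : (⁅B, (⊤ : Subgroup G)⁆).Normal).conj_mem _
    (commutator_mem_commutator hb (mem_top q)) a

/-- `⁅A ⊔ lcs k, ⊤⁆ ≤ ⁅A, ⊤⁆ ⊔ lcs (k+1)`. [folklore] -/
theorem commutator_sup_lcs_top_le (A : Subgroup G) [A.Normal] (k : ℕ) :
    ⁅A ⊔ ((⊤ : Subgroup G).lowerCentralSeries k), (⊤ : Subgroup G)⁆ ≤ ⁅A, (⊤ : Subgroup G)⁆ ⊔ ((⊤ : Subgroup G).lowerCentralSeries (k + 1)) :=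
  commutator_sup_top_le A _

/-- `⁅P, ⊤⁆ ⊔ lcs k ≤ P ⊔ lcs k` for normal `P`. [folklore] -/
theorem commutator_sup_lcs_le (P : Subgroup G) [P.Normal] (k : ℕ) :
    ⁅P, (⊤ : Subgroup G)⁆ ⊔ ((⊤ : Subgroup G).lowerCentralSeries k) ≤ P ⊔ ((⊤ : Subgroup G).lowerCentralSeries k) :=
  sup_le_sup_right (commutator_le_left P ⊤) _

/-- **Level-`c` intersection.** For normal `Q` without hidden depth (`Q ⊓ γ₂ ≤ ⁅Q, ⊤⁆`) and
normal `P` with the same level-`c` shadow (`Q ⊔ lcs (c+1) = P ⊔ lcs (c+1)`), the `lcs (c+1)`-part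
of the level-`(c+1)` kernel `Q ⊔ lcs (c+2)` does not depend on `Q`:
`(Q ⊔ lcs (c+2)) ⊓ lcs (c+1) = (⁅P, ⊤⁆ ⊔ lcs (c+2)) ⊓ lcs (c+1)`. [folklore] -/
theorem level_inf (c : ℕ) (Q P : Subgroup G) [Q.Normal] [P.Normal]
    (hQ : Q ⊓ ((⊤ : Subgroup G).lowerCentralSeries 1) ≤ ⁅Q, (⊤ : Subgroup G)⁆)
    (hQP : Q ⊔ ((⊤ : Subgroup G).lowerCentralSeries (c + 1)) = P ⊔ ((⊤ : Subgroup G).lowerCentralSeries (c + 1))) :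
    (Q ⊔ ((⊤ : Subgroup G).lowerCentralSeries (c + 2))) ⊓ ((⊤ : Subgroup G).lowerCentralSeries (c + 1)) = (⁅P, (⊤ : Subgroup G)⁆ ⊔ ((⊤ : Subgroup G).lowerCentralSeries (c + 2))) ⊓ ((⊤ : Subgroup G).lowerCentralSeries (c + 1)) := by
  apply le_antisymm
  · intro x hx12
    obtain ⟨hx, hx1⟩ := Subgroup.mem_inf.1 hx12
    obtain ⟨q, hq, z, hz, rfl⟩ := mem_sup_of_normal_right.1 hx
    have hqc : q ∈ ((⊤ : Subgroup G).lowerCentralSeries (c + 1)) := by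
      have e : q * z * z⁻¹ = q := by group
      rw [← e]
      exact mul_mem hx1 (inv_mem (lcs_antitone (Nat.le_succ _) hz))
    have hq1 : q ∈ Q ⊓ ((⊤ : Subgroup G).lowerCentralSeries 1) :=
      Subgroup.mem_inf.2 ⟨hq, lcs_antitone (Nat.succ_le_succ (Nat.zero_le c)) hqc⟩
    have hq3 : q ∈ ⁅P, (⊤ : Subgroup G)⁆ ⊔ ((⊤ : Subgroup G).lowerCentralSeries (c + 2)) := by
      have h1 : ⁅Q, (⊤ : Subgroup G)⁆ ≤ ⁅P ⊔ ((⊤ : Subgroup G).lowerCentralSeries (c + 1)), ⊤⁆ :=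
        commutator_mono (le_sup_left.trans hQP.le) le_rfl
      exact (h1.trans (commutator_sup_lcs_top_le P (c + 1))) (hQ hq1)
    exact Subgroup.mem_inf.2 ⟨mul_mem hq3 (mem_sup_right hz), hx1⟩
  · intro x hx12
    obtain ⟨hx, hx1⟩ := Subgroup.mem_inf.1 hx12
    refine Subgroup.mem_inf.2 ⟨?_, hx1⟩
    have h1 : ⁅P, (⊤ : Subgroup G)⁆ ≤ ⁅Q ⊔ ((⊤ : Subgroup G).lowerCentralSeries (c + 1)), ⊤⁆ :=
      commutator_mono (le_sup_left.trans hQP.ge) le_rfl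
    have h2 : ⁅P, (⊤ : Subgroup G)⁆ ⊔ ((⊤ : Subgroup G).lowerCentralSeries (c + 2)) ≤ Q ⊔ ((⊤ : Subgroup G).lowerCentralSeries (c + 2)) :=
      sup_le ((h1.trans (commutator_sup_lcs_top_le Q (c + 1))).trans (commutator_sup_lcs_le Q _))
        le_sup_right
    exact h2 hx

/-- **Level-`c` data.** For normal `Q` without hidden depth and normal `R ≤ Q` generating `Q`
modulo `lcs (c+1)` (`Q ≤ R ⊔ lcs (c+1)`), `Q ⊔ lcs (c+2) = R ⊔ lcs (c+2)`: the level-`(c+1)`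
kernel is the normal closure of any lifts of its level-`c` generators, up to `lcs (c+2)`.
[folklore] -/
theorem level_data (c : ℕ) (Q R : Subgroup G) [Q.Normal] [R.Normal]
    (hQ : Q ⊓ ((⊤ : Subgroup G).lowerCentralSeries 1) ≤ ⁅Q, (⊤ : Subgroup G)⁆) (hRQ : R ≤ Q) (hQR : Q ≤ R ⊔ ((⊤ : Subgroup G).lowerCentralSeries (c + 1))) :
    Q ⊔ ((⊤ : Subgroup G).lowerCentralSeries (c + 2)) = R ⊔ ((⊤ : Subgroup G).lowerCentralSeries (c + 2)) := by
  refine le_antisymm (sup_le ?_ le_sup_right) (sup_le_sup_right hRQ _)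
  intro q hq
  obtain ⟨r, hr, z, hz, rfl⟩ := mem_sup_of_normal_right.1 (hQR hq)
  have hz1 : z ∈ Q ⊓ ((⊤ : Subgroup G).lowerCentralSeries 1) := by
    refine Subgroup.mem_inf.2 ⟨?_, lcs_antitone (Nat.succ_le_succ (Nat.zero_le c)) hz⟩
    have e : r⁻¹ * (r * z) = z := by group
    rw [← e]
    exact mul_mem (inv_mem (hRQ hr)) hq
  have h1 : ⁅Q, (⊤ : Subgroup G)⁆ ≤ ⁅R ⊔ ((⊤ : Subgroup G).lowerCentralSeries (c + 1)), ⊤⁆ := commutator_mono hQR le_rfl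
  have hz2 : z ∈ R ⊔ ((⊤ : Subgroup G).lowerCentralSeries (c + 2)) :=
    ((h1.trans (commutator_sup_lcs_top_le R (c + 1))).trans (commutator_sup_lcs_le R _)) (hQ hz1)
  exact mul_mem (mem_sup_left hr) hz2

/-- **Membership criterion in torsor coordinates, level `c`.** With `Q`, `P` as in `level_inf`,
a correction `u ∈ lcs (c+1)` with `u x ∈ Q`, and `y ≡ x (mod lcs (c+1))`:
`y ∈ Q ⊔ lcs (c+2) ↔ y x⁻¹ u⁻¹ ∈ ⁅P, ⊤⁆ ⊔ lcs (c+2)`. [folklore] -/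
theorem level_mem_iff (c : ℕ) (Q P : Subgroup G) [Q.Normal] [P.Normal]
    (hQ : Q ⊓ ((⊤ : Subgroup G).lowerCentralSeries 1) ≤ ⁅Q, (⊤ : Subgroup G)⁆)
    (hQP : Q ⊔ ((⊤ : Subgroup G).lowerCentralSeries (c + 1)) = P ⊔ ((⊤ : Subgroup G).lowerCentralSeries (c + 1)))
    {u x y : G} (hux : u * x ∈ Q) (hyx : y * x⁻¹ ∈ ((⊤ : Subgroup G).lowerCentralSeries (c + 1))) (hu : u ∈ ((⊤ : Subgroup G).lowerCentralSeries (c + 1))) :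
    y ∈ Q ⊔ ((⊤ : Subgroup G).lowerCentralSeries (c + 2)) ↔ y * x⁻¹ * u⁻¹ ∈ ⁅P, (⊤ : Subgroup G)⁆ ⊔ ((⊤ : Subgroup G).lowerCentralSeries (c + 2)) := by
  have hux' : u * x ∈ Q ⊔ ((⊤ : Subgroup G).lowerCentralSeries (c + 2)) := mem_sup_left hux
  have e : y * x⁻¹ * u⁻¹ = y * (u * x)⁻¹ := by group
  have hmem1 : y * x⁻¹ * u⁻¹ ∈ ((⊤ : Subgroup G).lowerCentralSeries (c + 1)) := mul_mem hyx (inv_mem hu)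
  constructor
  · intro hy
    have h2 : y * x⁻¹ * u⁻¹ ∈ (Q ⊔ ((⊤ : Subgroup G).lowerCentralSeries (c + 2))) ⊓ ((⊤ : Subgroup G).lowerCentralSeries (c + 1)) := by
      refine Subgroup.mem_inf.2 ⟨?_, hmem1⟩
      rw [e]
      exact mul_mem hy (inv_mem hux')
    rw [level_inf c Q P hQ hQP] at h2
    exact (Subgroup.mem_inf.1 h2).1
  · intro h
    have h2 : y * x⁻¹ * u⁻¹ ∈ (Q ⊔ ((⊤ : Subgroup G).lowerCentralSeries (c + 2))) ⊓ ((⊤ : Subgroup G).lowerCentralSeries (c + 1)) := by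
      rw [level_inf c Q P hQ hQP]
      exact Subgroup.mem_inf.2 ⟨h, hmem1⟩
    have h' := (Subgroup.mem_inf.1 h2).1
    rw [e] at h'
    have e2 : y * (u * x)⁻¹ * (u * x) = y := by group
    rw [← e2]
    exact mul_mem h' hux'

/-- **The torsor target is a free-quotient quantity.** For a normal `P` without hidden depth and
`w ∈ lcs (c+1)`: `w ∈ ⁅P, ⊤⁆ ⊔ lcs (c+2) ↔ (w : G ⧸ P) ∈ lcs (G ⧸ P) (c+2)`.  With `P = Nᵢ` and
`S ⧸ Nᵢ ≅ F_g` (free on the mates of the cut letters) the congruences of the torsor goal therefore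
live in `γ_{c+2}F_g / γ_{c+3}F_g` — Magnus–Witt territory (free groups), no Labute. [folklore] -/
theorem target_iff_quotient (c : ℕ) (P : Subgroup G) [P.Normal]
    (hP : P ⊓ ((⊤ : Subgroup G).lowerCentralSeries 1) ≤ ⁅P, (⊤ : Subgroup G)⁆) {w : G} (hw : w ∈ ((⊤ : Subgroup G).lowerCentralSeries (c + 1))) :
    w ∈ ⁅P, (⊤ : Subgroup G)⁆ ⊔ ((⊤ : Subgroup G).lowerCentralSeries (c + 2)) ↔ (w : G ⧸ P) ∈ (⊤ : Subgroup (G ⧸ P)).lowerCentralSeries (c + 2) := by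
  have hmap : (⊤ : Subgroup (G ⧸ P)).lowerCentralSeries (c + 2) = (((⊤ : Subgroup G).lowerCentralSeries (c + 2))).map (QuotientGroup.mk' P) := by
    rw [Subgroup.map_lowerCentralSeries, ← MonoidHom.range_eq_map,
      MonoidHom.range_eq_top.2 (QuotientGroup.mk'_surjective P)]
  constructor
  · intro h
    rw [hmap]
    obtain ⟨p, hp, z, hz, rfl⟩ := mem_sup_of_normal_right.1 h
    refine ⟨z, hz, ?_⟩
    rw [QuotientGroup.mk'_apply, QuotientGroup.mk_mul,
      (QuotientGroup.eq_one_iff p).2 (commutator_le_left P ⊤ hp), one_mul]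
  · intro h
    rw [hmap] at h
    obtain ⟨z, hz, hzw⟩ := h
    have h1 : z⁻¹ * w ∈ P := QuotientGroup.eq.1 hzw
    have h2 : w ∈ P ⊔ ((⊤ : Subgroup G).lowerCentralSeries (c + 2)) := by
      have e : w = z * (z⁻¹ * w) := by group
      rw [e, sup_comm]
      exact mul_mem (mem_sup_left hz) (mem_sup_right h1)
    have h3 : w ∈ (P ⊔ ((⊤ : Subgroup G).lowerCentralSeries (c + 2))) ⊓ ((⊤ : Subgroup G).lowerCentralSeries (c + 1)) := Subgroup.mem_inf.2 ⟨h2, hw⟩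
    rw [level_inf c P P hP rfl] at h3
    exact (Subgroup.mem_inf.1 h3).1

end General

/-! ## Registered helper (surface-group specialisation, the form consumed by the REACH stubs) -/

/-- **Registered helper `helper_torsorLevelMemIff`** (sub-goal of the lead's skeleton for crux
stmt-SmoothPoincare4-14594): the membership criterion `level_mem_iff` specialised to the surface groups
`Literature.Topology.FourManifolds.SurfaceGroup g`, in closed `∀`-form. [folklore] -/
theorem helper_torsorLevelMemIff : ∀ (g c : ℕ) (Q P : Subgroup (Literature.Topology.FourManifolds.SurfaceGroup g)) [Q.Normal] [P.Normal], Q ⊓ (⊤ : Subgroup (Literature.Topology.FourManifolds.SurfaceGroup g)).lowerCentralSeries 1 ≤ ⁅Q, (⊤ : Subgroup (Literature.Topology.FourManifolds.SurfaceGroup g))⁆ → Q ⊔ (⊤ : Subgroup (Literature.Topology.FourManifolds.SurfaceGroup g)).lowerCentralSeries (c + 1) = P ⊔ (⊤ : Subgroup (Literature.Topology.FourManifolds.SurfaceGroup g)).lowerCentralSeries (c + 1) → ∀ (u x y : Literature.Topology.FourManifolds.SurfaceGroup g), u * x ∈ Q → y * x⁻¹ ∈ (⊤ : Subgroup (Literature.Topology.FourManifolds.SurfaceGroup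 g)).lowerCentralSeries (c + 1) → u ∈ (⊤ : Subgroup (Literature.Topology.FourManifolds.SurfaceGroup g)).lowerCentralSeries (c + 1) → (y ∈ Q ⊔ (⊤ : Subgroup (Literature.Topology.FourManifolds.SurfaceGroup g)).lowerCentralSeries (c + 2) ↔ y * x⁻¹ * u⁻¹ ∈ ⁅P, (⊤ : Subgroup (Literature.Topology.FourManifolds.SurfaceGroup g))⁆ ⊔ (⊤ : Subgroup (Literature.Topology.FourManifolds.SurfaceGroup g)).lowerCentralSeries (c + 2)) :=
  fun _ c Q P _ _ hQ hQP _ _ _ hux hyx hu => level_mem_iff c Q P hQ hQP hux hyx hu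

end Summit.SmoothPoincare4.SmoothPoincare4.Theorems.NilpotentShadowsStandard.SaturatedTorsorDescent

end
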